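import Summits.AtomisticToContinuum.HydrodynamicLimit.Theses.JParityClosure
import Summits.AtomisticToContinuum.HydrodynamicLimit.Theorems.LocalSecondLaw.Negative.Functional

/-!
# Vocabulary of the entropy-ledger line for the crux `JParityClosure.LocalSecondLaw`
(stmt-AtomisticToContinuum-13081, line `exact-entropy-ledger-three-passivities`)

Route-posited finite-`N` statistics used by the registered stubs of the picked line
(`Cruxes/LocalSecondLaw/Lines/exact-entropy-ledger-three-passivities.lean`) and by its kernel-checked composition
`LocalSecondLaw_of`: the coarse velocity `u_r`, the traceless peculiar stress `Σ^dev_r`, the kinetic heat current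
`q^kin_r`, the excess pressure `p_ex`, the contact geometry of an ordered pair (`nrm`, `vin`, `impulse`), Hardy's bond
weight `bondC`, the collision sum `collSum` (normalisation `ε/(N+1)`, contact test verbatim that of cruxes 2–4), the three
ledger statistics `T₁` (kinetic-anisotropy work), `T₂ = T₂smooth + T₂coll` (collisional-pressure-excess work),
`T₃ = T₃kin + T₃coll` (heat-current pairing), the particle-side boundary term `bdry`, the regular event `Regular`
(good orbit + density floor/cap + temperature floor on `[0,τ] × 𝕋³`) and the equation-of-state band `EosBand`.
Everything is built over the LANDED pieces of the crux functional (`cone`, `rhoC`, `momC`, `kinC`, `thetaC`, `Hs`,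
`entropyFunctional` of `Theorems/LocalSecondLaw/Negative/Functional.lean`, definitionally the crux's `let`-tower), the
crux's own `Torus.partialDeriv`, and the collision bookkeeping of the route (`collisionTimes`, `sepVec`, `reflectVel`).
Texts are byte-identical to the registered skeleton's (only the namespace differs), so that stub proofs under
`Theorems/` can state the registered signatures without importing a `Cruxes/Lines` file.

References: J. H. Irving, J. G. Kirkwood, J. Chem. Phys. 18 (1950) 817 and R. J. Hardy, J. Chem. Phys. 76 (1982) 622
(microscopic stress / heat current with bond functions); H. Spohn, *Large Scale Dynamics of Interacting Particles*
(1991), Part I §3 (setting).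
-/

noncomputable section

namespace Summit.AtomisticToContinuum.HydrodynamicLimit.Theorems.LocalSecondLawLedger

open scoped BigOperators Topology Classical MeasureTheory ENNReal InnerProductSpace
open Filter Set MeasureTheory
open Literature.MathematicalPhysics.KineticTheory
open Literature.Analysis.FluidPDE
open Summit.AtomisticToContinuum.HydrodynamicLimit.Theorems.LocalSecondLawNegative


/-- The hard-sphere flows of the frame: `N + 1` spheres of diameter `ε_N = hsDiameter σ N` on `𝕋³`. -/
abbrev Flow (σ : ℝ) (N : ℕ) : Type :=
  HardSphereFlow (Torus.geometry (Fin 3)) (hsDiameter σ N) (N + 1)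

/-- Phase space of `N + 1` spheres on `𝕋³`. -/
abbrev Phase (N : ℕ) : Type := Config (N + 1) (Fin 3) T3

/-- The crux's partial derivative `∂ₖ` of a scalar field on `𝕋³` (junk `0` where not differentiable; the cone fields are
Lipschitz, so this is the a.e. derivative). -/
abbrev pD (k : Fin 3) (f : T3 → ℝ) (x : T3) : ℝ :=
  Literature.Analysis.FunctionSpaces.Torus.partialDeriv k f x

/-- The covering map `ℝ³ → 𝕋³` (torus translation is `x + tproj v`, = `(Torus.geometry (Fin 3)).translate x v`). -/
abbrev tproj (v : V3) : T3 := Literature.Analysis.FunctionSpaces.Torus.proj v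

variable {N : ℕ}

/-- Coarse velocity `u_r = m_r / ρ_r` (junk `0` where `ρ_r = 0`; never met on the regular range). -/
def uC (r : ℝ) (w : Phase N) (x₀ : T3) : V3 :=
  (rhoC r w x₀)⁻¹ • momC r w x₀

/-- Traceless peculiar kinetic stress `Σ^dev_{kl} = (N+1)⁻¹∑ᵢ b_r(xᵢ,x₀)(vᵢ−u_r)ₖ(vᵢ−u_r)ₗ − ρ_rθ_r δ_{kl}`
(exactly traceless: `tr = 2e_r − ρ_r|u_r|² − 3ρ_rθ_r = 0` by the definition of `θ_r`). -/
def devC (r : ℝ) (w : Phase N) (x₀ : T3) (k l : Fin 3) : ℝ :=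
  (∫ q, cone r q.1 x₀ * ((q.2 k - uC r w x₀ k) * (q.2 l - uC r w x₀ l)) ∂(empiricalMeasure w))
    - rhoC r w x₀ * thetaC r w x₀ * (if k = l then 1 else 0)

/-- Kinetic heat current `q^kin_r = (N+1)⁻¹∑ᵢ b_r(xᵢ,x₀) |vᵢ−u_r|²/2 (vᵢ−u_r)` — the CUBIC peculiar moment. -/
def qkinC (r : ℝ) (w : Phase N) (x₀ : T3) : V3 :=
  ∫ q, (cone r q.1 x₀ * (‖q.2 - uC r w x₀‖ ^ 2 / 2)) • (q.2 - uC r w x₀) ∂(empiricalMeasure w)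

/-- Thermodynamic excess (collisional-transfer) pressure of the hard-sphere equation of state at the coarse state:
`p_ex = hsPressure σ ρ_r θ_r − ρ_rθ_r = ρ_rθ_r(Z(ρ_rσ³) − 1)`. -/
def pexC (σ r : ℝ) (w : Phase N) (x₀ : T3) : ℝ :=
  hsPressure σ (rhoC r w x₀) (thetaC r w x₀) - rhoC r w x₀ * thetaC r w x₀

/-- Unit contact normal of the ordered pair `(i, j)`, pointing from `j` to `i`: `n̂ = ε⁻¹ sepVec xᵢ xⱼ` (as in cruxes 2–4). -/
def nrm (ε : ℝ) (w : Phase N) (i j : Fin (N + 1)) : V3 :=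
  ε⁻¹ • (Torus.geometry (Fin 3)).sepVec (w i).1 (w j).1

/-- Incoming (pre-collisional) velocities `(v⁻, w⁻)` of the ordered pair, read off the right-continuous
(post-collisional) state by the reflection involution (as in cruxes 2–4). -/
def vin (w : Phase N) (i j : Fin (N + 1)) : V3 × V3 :=
  reflectVel ((Torus.geometry (Fin 3)).sepVec (w i).1 (w j).1) ((w i).2, (w j).2)

/-- Normal momentum transfer to `i`: `a = ((w⁻ − v⁻)·n̂)₊`, so that `Δvᵢ = a n̂` on a genuine collision — the scalar of
EvenStressEnskog's mark `Ξ_P^{kl} = a n̂ₖ n̂ₗ`. -/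
def impulse (ε : ℝ) (w : Phase N) (i j : Fin (N + 1)) : ℝ :=
  max ⟪(vin w i j).2 - (vin w i j).1, nrm ε w i j⟫_ℝ 0

/-- Hardy's bond weight: the cone kernel averaged along the contact segment from `xⱼ` to `xᵢ`,
`b̄(x₀) = ∫₀¹ b_r(xⱼ + λ·sepVec xᵢ xⱼ, x₀) dλ`; `εn̂ b̄` is the vector potential with `−div(εn̂ b̄) = b_r(xᵢ,·) − b_r(xⱼ,·)`. -/
def bondC (r : ℝ) (w : Phase N) (i j : Fin (N + 1)) (x₀ : T3) : ℝ :=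
  ∫ l in Set.Icc (0 : ℝ) 1,
    cone r ((w j).1 + tproj (l • (Torus.geometry (Fin 3)).sepVec (w i).1 (w j).1)) x₀

/-- The collision sum of the frame, `(ε/(N+1)) ∑_{collision times s ∈ (0,τ]} ∑_{ordered contact pairs (i,j)} f s (Φₛz) i j`
(normalisation and contact test verbatim those of cruxes 2–4; times in `(0, τ]` as in EmpiricalEnskogIdentity, since the
state at a collision time is post-collisional). -/
def collSum (σ τ : ℝ) (Φ : Flow σ N) (z : Phase N)
    (f : ℝ → Phase N → Fin (N + 1) → Fin (N + 1) → ℝ) : ℝ :=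
  hsDiameter σ N / (N + 1 : ℝ) *
    ∑ᶠ (s : ℝ) (_ : s ∈ collisionTimes (Torus.geometry (Fin 3)) (hsDiameter σ N) (fun t => Φ.flow t z) ∩
        Set.Ioc 0 τ),
      ∑ i : Fin (N + 1), ∑ j : Fin (N + 1),
        (if i ≠ j ∧ ‖(Torus.geometry (Fin 3)).sepVec (Φ.flow s z i).1 (Φ.flow s z j).1‖ = hsDiameter σ N then
          f s (Φ.flow s z) i j else 0)

/-- **T1 — kinetic-anisotropy work**: `T1 = −∫₀^τ∫ (φ/θ_r) Σ^dev_r : ∇u_r`. -/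
def T₁ (σ r τ : ℝ) (φ : ℝ → T3 → ℝ) (Φ : Flow σ N) (z : Phase N) : ℝ :=
  -∫ s in Set.Icc (0 : ℝ) τ, ∫ x : T3,
      φ s x / thetaC r (Φ.flow s z) x *
        ∑ k : Fin 3, ∑ l : Fin 3, devC r (Φ.flow s z) x k l * pD k (fun y => uC r (Φ.flow s z) y l) x

/-- Smooth (configurational) half of T2: `+∫₀^τ∫ (φ/θ_r) p_ex(ρ_r,θ_r) div u_r` — what the `ρ f_ex` part of the crux
functional produces by exact continuity (the card's First lemma `ConfigurationalWorkIdentity`). -/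
def T₂smooth (σ r τ : ℝ) (φ : ℝ → T3 → ℝ) (Φ : Flow σ N) (z : Phase N) : ℝ :=
  ∫ s in Set.Icc (0 : ℝ) τ, ∫ x : T3,
    φ s x / thetaC r (Φ.flow s z) x * pexC σ r (Φ.flow s z) x *
      ∑ k : Fin 3, pD k (fun y => uC r (Φ.flow s z) y k) x

/-- Collisional half of T2: `−∫∫ (φ/θ_r) P^c_r : ∇u_r`, `P^c_r = (ε/(N+1)) ∑_coll δ(s−s_c) a b̄ n̂⊗n̂` Hardy's (positive
semi-definite, rank one per collision) contact stress; ordered pairs carry weight `1/2`; fields read post-collision. -/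
def T₂coll (σ r τ : ℝ) (φ : ℝ → T3 → ℝ) (Φ : Flow σ N) (z : Phase N) : ℝ :=
  -collSum σ τ Φ z (fun s w i j =>
    (1 / 2 : ℝ) * ∫ x : T3,
      φ s x / thetaC r w x * bondC r w i j x * impulse (hsDiameter σ N) w i j *
        ∑ k : Fin 3, ∑ l : Fin 3,
          nrm (hsDiameter σ N) w i j k * nrm (hsDiameter σ N) w i j l * pD k (fun y => uC r w y l) x)

/-- **T2 — collisional-pressure-excess work**: `T2 = −∫∫ (φ/θ_r) [P^c_r − p_ex 𝟙] : ∇u_r`. -/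
def T₂ (σ r τ : ℝ) (φ : ℝ → T3 → ℝ) (Φ : Flow σ N) (z : Phase N) : ℝ :=
  T₂smooth σ r τ φ Φ z + T₂coll σ r τ φ Φ z

/-- Kinetic half of T3: `+∫₀^τ∫ ∇(φ/θ_r) · q^kin_r`. -/
def T₃kin (σ r τ : ℝ) (φ : ℝ → T3 → ℝ) (Φ : Flow σ N) (z : Phase N) : ℝ :=
  ∫ s in Set.Icc (0 : ℝ) τ, ∫ x : T3,
    ∑ k : Fin 3, pD k (fun y => φ s y / thetaC r (Φ.flow s z) y) x * qkinC r (Φ.flow s z) x k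

/-- Collisional half of T3: `+∫∫ ∇(φ/θ_r) · q^c_r`, `q^c_r = (ε/(N+1)) ∑_coll δ(s−s_c) b̄ n̂ (a/2) n̂·(v⁻+w⁻−2u_r)` the
collisional energy transfer to `i` read in the frame `u_r(x₀)` (`Δvᵢ·((vᵢ⁻+vᵢ⁺)/2 − u_r)`), ordered pairs weight `1/2`. -/
def T₃coll (σ r τ : ℝ) (φ : ℝ → T3 → ℝ) (Φ : Flow σ N) (z : Phase N) : ℝ :=
  collSum σ τ Φ z (fun s w i j =>
    (1 / 2 : ℝ) * ∫ x : T3,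
      (∑ k : Fin 3, pD k (fun y => φ s y / thetaC r w y) x * nrm (hsDiameter σ N) w i j k) *
        bondC r w i j x * (impulse (hsDiameter σ N) w i j / 2) *
          ⟪(vin w i j).1 + (vin w i j).2 - (2 : ℝ) • uC r w x, nrm (hsDiameter σ N) w i j⟫_ℝ)

/-- **T3 — heat-current pairing**: `T3 = +∫∫ ∇(φ/θ_r) · (q^kin_r + q^c_r)`. -/
def T₃ (σ r τ : ℝ) (φ : ℝ → T3 → ℝ) (Φ : Flow σ N) (z : Phase N) : ℝ :=
  T₃kin σ r τ φ Φ z + T₃coll σ r τ φ Φ z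

/-- The particle-side boundary term `∫ H(ρ_r(Φ₀z), θ_r(Φ₀z)) φ₀` (= the crux's boundary term with the Euler datum
replaced by the coarse empirical state at `s = 0`; `Φ₀ z = z` on the good set). -/
def bdry (σ r : ℝ) (φ₀ : T3 → ℝ) (Φ : Flow σ N) (z : Phase N) : ℝ :=
  ∫ x : T3, Hs σ (rhoC r (Φ.flow 0 z) x) (thetaC r (Φ.flow 0 z) x) * φ₀ x

/-- The REGULAR event at fixed `r` (floors + cap + good orbit): `z ∈ good` and on `[0,τ] × 𝕋³` the coarse density is in
`[c, η₁/σ³]` and the coarse temperature is `≥ c`.  On it the guard of `Hs` is off, `f_ex` is evaluated inside the EOS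
band, `u_r`, `1/θ_r` are bounded and all cone fields are Lipschitz. -/
def Regular (σ r τ c η₁ : ℝ) (Φ : Flow σ N) (z : Phase N) : Prop :=
  z ∈ Φ.good ∧ ∀ s ∈ Set.Icc (0 : ℝ) τ, ∀ x : T3,
    c ≤ rhoC r (Φ.flow s z) x ∧ rhoC r (Φ.flow s z) x * σ ^ 3 ≤ η₁ ∧ c ≤ thetaC r (Φ.flow s z) x

/-- The equation-of-state band (the content of the route support `HsEosLowDensity`, stmt-0768, PROVED in the tree):
`F` real-analytic on `(−η₀, η₀)` and `f_ex = F` on `[0, η₀)`; so `f_ex` is `C^∞` on `(0, η₀)` and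
`deriv hsExcessFreeEnergy = deriv F` there (`hsCompressibility`, `hsPressure` are the thermodynamic ones). -/
def EosBand (η₀ : ℝ) (F : ℝ → ℝ) : Prop :=
  0 < η₀ ∧ AnalyticOnNhd ℝ F (Set.Ioo (-η₀) η₀) ∧ Set.EqOn hsExcessFreeEnergy F (Set.Ico 0 η₀)

/-! ## Vocabulary lemmas -/

/-- The regular event lies in the good set of the flow (first conjunct of `Regular`). -/
theorem regular_mem_good :
    ∀ {N : ℕ} (σ r τ c η₁ : ℝ) (Φ : Flow σ N) (z : Phase N), Regular σ r τ c η₁ Φ z → z ∈ Φ.good :=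
  fun _ _ _ _ _ _ _ h => h.1

/-- On the regular event the coarse density is bounded below by the floor on `[0,τ] × 𝕋³`. -/
theorem Regular.rhoC_ge {N : ℕ} {σ r τ c η₁ : ℝ} {Φ : Flow σ N} {z : Phase N}
    (h : Regular σ r τ c η₁ Φ z) {s : ℝ} (hs : s ∈ Set.Icc (0 : ℝ) τ) (x : T3) :
    c ≤ rhoC r (Φ.flow s z) x :=
  (h.2 s hs x).1

/-- On the regular event the reduced coarse density is capped by `η₁` on `[0,τ] × 𝕋³`. -/
theorem Regular.rhoC_cap {N : ℕ} {σ r τ c η₁ : ℝ} {Φ : Flow σ N} {z : Phase N}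
    (h : Regular σ r τ c η₁ Φ z) {s : ℝ} (hs : s ∈ Set.Icc (0 : ℝ) τ) (x : T3) :
    rhoC r (Φ.flow s z) x * σ ^ 3 ≤ η₁ :=
  (h.2 s hs x).2.1

/-- On the regular event the coarse temperature is bounded below by the floor on `[0,τ] × 𝕋³`. -/
theorem Regular.thetaC_ge {N : ℕ} {σ r τ c η₁ : ℝ} {Φ : Flow σ N} {z : Phase N}
    (h : Regular σ r τ c η₁ Φ z) {s : ℝ} (hs : s ∈ Set.Icc (0 : ℝ) τ) (x : T3) :
    c ≤ thetaC r (Φ.flow s z) x :=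
  (h.2 s hs x).2.2

/-- `T₂` is the sum of its smooth and collisional halves (definitional). -/
theorem T₂_eq {N : ℕ} (σ r τ : ℝ) (φ : ℝ → T3 → ℝ) (Φ : Flow σ N) (z : Phase N) :
    T₂ σ r τ φ Φ z = T₂smooth σ r τ φ Φ z + T₂coll σ r τ φ Φ z := rfl

/-- `T₃` is the sum of its kinetic and collisional halves (definitional). -/
theorem T₃_eq {N : ℕ} (σ r τ : ℝ) (φ : ℝ → T3 → ℝ) (Φ : Flow σ N) (z : Phase N) :
    T₃ σ r τ φ Φ z = T₃kin σ r τ φ Φ z + T₃coll σ r τ φ Φ z := rfl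

/-- The boundary statistic is the landed crux pieces read at `Φ₀ z` (definitional bridge). -/
theorem bdry_eq {N : ℕ} (σ r : ℝ) (φ₀ : T3 → ℝ) (Φ : Flow σ N) (z : Phase N) :
    bdry σ r φ₀ Φ z = ∫ x : T3, Hs σ (rhoC r (Φ.flow 0 z) x) (thetaC r (Φ.flow 0 z) x) * φ₀ x := rfl

end Summit.AtomisticToContinuum.HydrodynamicLimit.Theorems.LocalSecondLawLedger

end
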